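import Mathlib
import HarnessLib.Audit
import Summits.PneNP.PneNP.Theorems.PstarGateCaseTStructure
import Summits.PneNP.PneNP.Theorems.PstarGateCaseTOffQ
import Summits.PneNP.PneNP.Theorems.PstarGateCaseTRankSix
import Summits.PneNP.PneNP.Theorems.PstarGateU2BranchB
import Summits.PneNP.PneNP.Theorems.PstarGateU2Joins
import Summits.PneNP.PneNP.Theorems.PstarBridgeUnread

/-!
# One GATED chord, CASE T: the gated-cycle budget, and private tree edges lie on the gated cycle (E2 node N3X; prover-1 g19)

FRONTIER range-avoidance ladder, rung F-N3 (`stmt-PneNP-19007`), cell `pnp-ideate` (`PstarGateNodesX`); restricted-model proof complexity —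
nothing here bears on `P` versus `NP`.

Two counting tools for the N3X endgame.

* `cycle_budget` — **expansion of `C_e ∪ {g₀}`**: `#D e ≤ 2·#Pd + 2·[no edge of D e through u]`, where `Pd` = the `u`-avoiding edges of `D e`
  sharing no AND variable with another edge of `D e` (every other edge of `D e` pays `≤ 1`: `u` to the gate, or a shared slot).
* `private_mem_cycle` — **in CASE T with affine `q_mv`, every tree edge that is private within `J₀ ∪ {g₀}` lies on `D e`, avoids `u`, and is in
  `Pd`**: a private edge on another fundamental set but off `D e` would be the `u`-edge of that chord (`caseT_through`); a private edge on no
  fundamental set is either unread (`false_of_bridge_minimal`) or in `T₂`, and then the four chamber points `y, y + e_a, y + e_b, y + e_a + e_b`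
  off `u_e` (`q = σ₀ + 1` there, `caseT_off_q`) contradict `polarDir (1,0)(e_a, e_b) = [b ∈ T₂] = 1`.
-/

set_option linter.dupNamespace false -- `Summit.PneNP.PneNP.…`: summit = sub-problem name (D-0017 single-conjunct layout)

open Finset Module Literature.Computability.Complexity
open scoped symmDiff
open Summit.PneNP.PneNP.Theorems.PstarTyped (Typed)
open Summit.PneNP.PneNP.Theorems.PstarSALevel (varSet bdry BoundaryExpanding SimpleOverlap)
open Summit.PneNP.PneNP.Theorems.PstarGapLinearised (andPair andPair_subset_varSet)
open Summit.PneNP.PneNP.Theorems.PstarChordEndgameTools (mem_andPair_iff)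
open Summit.PneNP.PneNP.Theorems.PstarCentreFree (vars_mem_varSet)
open Summit.PneNP.PneNP.Theorems.PstarCoreBound (XorClosed)
open Summit.PneNP.PneNP.Theorems.PstarCubeIdeals (IsAffineFn)
open Summit.PneNP.PneNP.Theorems.PstarForcing (polar_unique)
open Summit.PneNP.PneNP.Theorems.PstarProductRank (qform polar)
open Summit.PneNP.PneNP.Theorems.PstarReadSumset (V2)
open Summit.PneNP.PneNP.Theorems.PstarChordSystem (ChordSystem)
open Summit.PneNP.PneNP.Theorems.PstarChordBridgeTools (privs coef)
open Summit.PneNP.PneNP.Theorems.PstarChordBridge (BridgeData sys Solution Lift infeasible_of_not_solution)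
open Summit.PneNP.PneNP.Theorems.PstarChordBridgeForcing (gam sys_u_eq)
open Summit.PneNP.PneNP.Theorems.PstarChordBridgeBasis (qDir polarDir)
open Summit.PneNP.PneNP.Theorems.PstarChordBridgeCorner (qDir_add)
open Summit.PneNP.PneNP.Theorems.PstarNorCoreTools (not_mem_bdry_of_two card_varSet_inter_bdry_le card_bdry_le_sum)
open Summit.PneNP.PneNP.Theorems.PstarNorUnitBridge (xor_not_mem_bdry_of_even)
open Summit.PneNP.PneNP.Theorems.PstarNorUnitEQ1Tools (polarDir_single_pair)
open Summit.PneNP.PneNP.Theorems.PstarGateBridge (GateHyp)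
open Summit.PneNP.PneNP.Theorems.PstarGateHyperplane (qform_single_and)
open Summit.PneNP.PneNP.Theorems.PstarGateCaseTLocal (u_add)
open Summit.PneNP.PneNP.Theorems.PstarGateCasePNorHolders (not_mem_bdry_sup card_three_slots)
open Summit.PneNP.PneNP.Theorems.PstarGateNodes (GateData)
open Summit.PneNP.PneNP.Theorems.PstarGateNodesX (GateDataX)
open Summit.PneNP.PneNP.Theorems.PstarGateU2BranchB (exists_off_on_chamber)
open Summit.PneNP.PneNP.Theorems.PstarGateU2Joins (polar_single_off)
open Summit.PneNP.PneNP.Theorems.PstarBridgeUnread (false_of_bridge_minimal)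
open Summit.PneNP.PneNP.Theorems.PstarGateCaseTOffQ (caseT_off_q)
open Summit.PneNP.PneNP.Theorems.PstarGateCaseTRankSix (sigma_const)
open Summit.PneNP.PneNP.Theorems.PstarGateCaseTStructure (caseT_through)

namespace Summit.PneNP.PneNP.Theorems.PstarGateCaseTN3Tools

variable {n m : ℕ}

/-- **Expansion of the gated cycle plus the gate.**  See the module docstring. -/
theorem cycle_budget (I : LocalMap 4 n m) (hI : I.IsPure xorAndPred) {r₀ : ℕ} (hB : BoundaryExpanding r₀ I) {B : BridgeData n m}
    {e g₀ : Fin m} {u : Fin n} {κ₀ : ZMod 2} (hD : GateDataX I r₀ B e g₀ u κ₀) :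
    (B.D e).card ≤
      2 * ((B.D e).filter (fun j => I.vars j 2 ≠ u ∧ I.vars j 3 ≠ u ∧
              ∀ j' ∈ B.D e, j' ≠ j → I.vars j 2 ∉ andPair I j' ∧ I.vars j 3 ∉ andPair I j')).card +
      (if ∃ j ∈ B.D e, I.vars j 2 = u ∨ I.vars j 3 = u then 0 else 2) := by
  classical
  obtain ⟨-, hW, hr, hd₁, -, -, -, -, hG, hg₀, hgv, -⟩ := id hD
  have he : e ∈ B.N := hG.1
  have heJ : e ∈ B.J₀ := hW.hN he
  have hg₀J : g₀ ∉ B.J₀ := fun h => disjoint_left.1 hd₁ hg₀ h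
  have heD : e ∉ B.D e := fun h => (mem_sdiff.1 (hW.hD e he h)).2 he
  have hDJ : B.D e ⊆ B.J₀ := fun j hj => (mem_sdiff.1 (hW.hD e he hj)).1
  set Pd := (B.D e).filter (fun j => I.vars j 2 ≠ u ∧ I.vars j 3 ≠ u ∧
    ∀ j' ∈ B.D e, j' ≠ j → I.vars j 2 ∉ andPair I j' ∧ I.vars j 3 ∉ andPair I j') with hPd
  set δ : ℕ := if ∃ j ∈ B.D e, I.vars j 2 = u ∨ I.vars j 3 = u then 0 else 1 with hδ
  have hgoal : (if ∃ j ∈ B.D e, I.vars j 2 = u ∨ I.vars j 3 = u then 0 else 2) = 2 * δ := by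
    rw [hδ]; split_ifs <;> rfl
  rw [hgoal]
  set Y : Finset (Fin m) := insert g₀ (insert e (B.D e)) with hYdef
  have hg₀Y' : g₀ ∉ insert e (B.D e) := by
    rw [mem_insert, not_or]; exact ⟨fun h => hg₀J (h ▸ heJ), fun h => hg₀J (hDJ h)⟩
  have hYcard : Y.card = (B.D e).card + 2 := by rw [hYdef, card_insert_of_notMem hg₀Y', card_insert_of_notMem heD]
  have hYr : Y.card ≤ r₀ := by
    refine (card_le_card (insert_subset (mem_union_left _ (mem_union_right _ hg₀)) (insert_subset ?_ fun j hj => ?_))).trans hr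
    · exact mem_union_left _ (mem_union_left _ heJ)
    · exact mem_union_left _ (mem_union_left _ (hDJ hj))
  have hg₀Y : g₀ ∈ Y := mem_insert_self _ _
  have heY : e ∈ Y := mem_insert_of_mem (mem_insert_self _ _)
  have hDY : ∀ j ∈ B.D e, j ∈ Y := fun j hj => mem_insert_of_mem (mem_insert_of_mem hj)
  have hCY : insert e (B.D e) ⊆ Y := subset_insert _ _
  have hxor : ∀ j ∈ insert e (B.D e), ∀ s : Fin 4, s.val < 2 → I.vars j s ∉ bdry I Y := fun j hj s hs =>
    not_mem_bdry_sup I hCY hj (vars_mem_varSet I j s) (xor_not_mem_bdry_of_even I hI (hW.hDeven e he) j hj s hs)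
  have hp_g₀ : I.vars e 2 ∈ varSet I g₀ := by rcases hgv with ⟨h, -⟩ | ⟨-, h⟩ <;> exact h ▸ vars_mem_varSet I g₀ _
  have hu_g₀ : u ∈ varSet I g₀ := by rcases hgv with ⟨-, h⟩ | ⟨h, -⟩ <;> exact h ▸ vars_mem_varSet I g₀ _
  let q : Fin m → ℕ := fun k => if k = g₀ then 2 + δ else if k ∈ Pd then 2 else 1
  have hq : ∀ k ∈ Y, (varSet I k ∩ bdry I Y).card ≤ q k := by
    intro k hk
    by_cases hkg₀ : k = g₀
    · subst hkg₀
      simp only [q, if_true]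
      by_cases hU : ∃ j ∈ B.D e, I.vars j 2 = u ∨ I.vars j 3 = u
      · have hδ0 : δ = 0 := by rw [hδ, if_pos hU]
        rw [hδ0, add_zero]
        obtain ⟨jᵤ, hjᵤ, hjᵤu⟩ := hU
        have hu_jᵤ : u ∈ varSet I jᵤ := by rcases hjᵤu with h | h <;> rw [← h] <;> exact vars_mem_varSet I jᵤ _
        have hjk : jᵤ ≠ k := fun h => hg₀J (h ▸ hDJ hjᵤ)
        have h := card_varSet_inter_bdry_le I Y k {2, 3} (fun s hs => by
          simp only [mem_insert, mem_singleton] at hs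
          rcases hs with rfl | rfl
          · rcases hgv with ⟨h2, -⟩ | ⟨h2, -⟩
            · exact not_mem_bdry_of_two I hk heY (fun h => hg₀J (h ▸ heJ)) (vars_mem_varSet I k 2) (h2 ▸ vars_mem_varSet I e 2)
            · exact not_mem_bdry_of_two I hk (hDY jᵤ hjᵤ) hjk.symm (vars_mem_varSet I k 2) (h2 ▸ hu_jᵤ)
          · rcases hgv with ⟨-, h3⟩ | ⟨-, h3⟩
            · exact not_mem_bdry_of_two I hk (hDY jᵤ hjᵤ) hjk.symm (vars_mem_varSet I k 3) (h3 ▸ hu_jᵤ)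
            · exact not_mem_bdry_of_two I hk heY (fun h => hg₀J (h ▸ heJ)) (vars_mem_varSet I k 3) (h3 ▸ vars_mem_varSet I e 2))
        rw [show ({2, 3} : Finset (Fin 4)).card = 2 by decide] at h; exact h
      · have hδ1 : δ = 1 := by rw [hδ, if_neg hU]
        rw [hδ1]
        obtain ⟨s, -, hps⟩ : ∃ s : Fin 4, 2 ≤ s.val ∧ I.vars k s = I.vars e 2 := by
          rcases hgv with ⟨h2, -⟩ | ⟨-, h3⟩; exact ⟨2, by decide, h2⟩; exact ⟨3, by decide, h3⟩
        have h := card_varSet_inter_bdry_le I Y k {s} (fun s' hs' => by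
          rw [mem_singleton] at hs'
          subst hs'
          exact not_mem_bdry_of_two I hk heY (fun h => hg₀J (h ▸ heJ)) (vars_mem_varSet I k s') (hps ▸ vars_mem_varSet I e 2))
        rw [card_singleton] at h; exact h
    have hk' : k ∈ insert e (B.D e) := by
      rw [hYdef, mem_insert] at hk
      rcases hk with h | h
      · exact absurd h hkg₀
      · exact h
    by_cases hkP : k ∈ Pd
    · simp only [q, if_neg hkg₀, if_pos hkP]
      have h := card_varSet_inter_bdry_le I Y k {0, 1} (fun s hs => by
        simp only [mem_insert, mem_singleton] at hs
        rcases hs with rfl | rfl <;> exact hxor k hk' _ (by decide))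
      rw [show ({0, 1} : Finset (Fin 4)).card = 2 by decide] at h; exact h
    simp only [q, if_neg hkg₀, if_neg hkP]
    obtain ⟨s, hs2, k', hk'Y, hnek, hv⟩ : ∃ s : Fin 4, 2 ≤ s.val ∧ ∃ k' ∈ Y, k' ≠ k ∧ I.vars k s ∈ varSet I k' := by
      rw [mem_insert] at hk'
      rcases hk' with rfl | hkD
      · exact ⟨2, by decide, g₀, hg₀Y, fun h => hg₀J (h ▸ heJ), hp_g₀⟩
      · have hgk : g₀ ≠ k := fun h => hg₀J (h ▸ hDJ hkD)
        by_cases h2 : I.vars k 2 = u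
        · exact ⟨2, by decide, g₀, hg₀Y, hgk, h2 ▸ hu_g₀⟩
        by_cases h3 : I.vars k 3 = u
        · exact ⟨3, by decide, g₀, hg₀Y, hgk, h3 ▸ hu_g₀⟩
        have hns : ¬ ∀ j' ∈ B.D e, j' ≠ k → I.vars k 2 ∉ andPair I j' ∧ I.vars k 3 ∉ andPair I j' :=
          fun h => hkP (mem_filter.2 ⟨hkD, h2, h3, h⟩)
        push Not at hns
        obtain ⟨j', hj', hj'k, hj'v⟩ := hns
        by_cases h2' : I.vars k 2 ∈ andPair I j'
        · exact ⟨2, by decide, j', hDY j' hj', hj'k, andPair_subset_varSet I j' h2'⟩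
        · exact ⟨3, by decide, j', hDY j' hj', hj'k, andPair_subset_varSet I j' (hj'v h2')⟩
    have h := card_varSet_inter_bdry_le I Y k {0, 1, s} (fun s' hs' => by
      simp only [mem_insert, mem_singleton] at hs'
      rcases hs' with rfl | rfl | rfl
      · exact hxor k hk' 0 (by decide)
      · exact hxor k hk' 1 (by decide)
      · exact not_mem_bdry_of_two I hk hk'Y (Ne.symm hnek) (vars_mem_varSet I k s') hv)
    rw [card_three_slots hs2] at h; exact h
  have hbd := card_bdry_le_sum I Y q hq
  have hPdD : Pd ⊆ B.D e := filter_subset _ _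
  have hsumD : ∑ k ∈ B.D e, q k = (B.D e).card + Pd.card := by
    have hsplit := (sum_filter_add_sum_filter_not (B.D e) (fun k => k ∈ Pd) q).symm
    have hf1 : (B.D e).filter (fun k => k ∈ Pd) = Pd := by
      ext k; simp only [mem_filter]; exact ⟨fun h => h.2, fun h => ⟨hPdD h, h⟩⟩
    rw [hsplit, hf1]
    have h1 : ∑ k ∈ Pd, q k = 2 * Pd.card := by
      rw [mul_comm, card_eq_sum_ones, sum_mul]
      refine sum_congr rfl fun k hk => ?_
      have hkg₀ : k ≠ g₀ := fun h => hg₀J (h ▸ hDJ (hPdD hk))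
      show (if k = g₀ then 2 + δ else if k ∈ Pd then 2 else 1) = 1 * 2
      rw [if_neg hkg₀, if_pos hk, one_mul]
    have h2 : ∑ k ∈ (B.D e).filter (fun k => k ∉ Pd), q k = ((B.D e).filter (fun k => k ∉ Pd)).card := by
      rw [card_eq_sum_ones]
      refine sum_congr rfl fun k hk => ?_
      obtain ⟨hkD, hkP⟩ := mem_filter.1 hk
      have hkg₀ : k ≠ g₀ := fun h => hg₀J (h ▸ hDJ hkD)
      show (if k = g₀ then 2 + δ else if k ∈ Pd then 2 else 1) = 1
      rw [if_neg hkg₀, if_neg hkP]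
    rw [h1, h2]
    have hc := card_filter_add_card_filter_not (s := B.D e) (fun k => k ∈ Pd)
    rw [hf1] at hc
    omega
  have heg₀ : e ≠ g₀ := fun h => hg₀J (h ▸ heJ)
  have heP : e ∉ Pd := fun h => heD (hPdD h)
  have hqg₀ : q g₀ = 2 + δ := by
    show (if g₀ = g₀ then 2 + δ else if g₀ ∈ Pd then 2 else 1) = 2 + δ; rw [if_pos rfl]
  have hqe : q e = 1 := by
    show (if e = g₀ then 2 + δ else if e ∈ Pd then 2 else 1) = 1; rw [if_neg heg₀, if_neg heP]
  have hsumY : ∑ k ∈ Y, q k = (2 + δ) + (1 + ((B.D e).card + Pd.card)) := by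
    rw [hYdef, sum_insert hg₀Y', sum_insert heD, hqg₀, hqe, hsumD]
  have hexp := hB Y hYr
  rw [hYcard] at hexp
  rw [hsumY] at hbd
  have hδle : δ ≤ 1 := by rw [hδ]; split_ifs <;> omega
  omega

/-- Second differences of a quadratic function along two directions. -/
private theorem quad_two {q : (Fin n → ZMod 2) → ZMod 2} {Bf : LinearMap.BilinForm (ZMod 2) (Fin n → ZMod 2)}
    (hq : ∀ x w, q (x + w) = q x + q w + q 0 + Bf x w) (y v w : Fin n → ZMod 2) :
    q (y + v + w) = q (y + v) + q (y + w) + q y + Bf v w := by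
  have h1 := hq (y + v) w
  have h2 := hq y w
  rw [map_add, LinearMap.add_apply] at h1
  rw [h1, h2]
  generalize q (y + v) = a; generalize q y = b; generalize q w = c; generalize q 0 = d; generalize Bf y w = s; generalize Bf v w = t
  revert a b c d s t; decide

/-- **Private tree edges lie on the gated cycle** (CASE T, affine `q_mv`).  See the module docstring. -/
theorem private_mem_cycle (I : LocalMap 4 n m) (hI : I.IsPure xorAndPred) (hT : Typed I) (hS : SimpleOverlap I) {r₀ : ℕ}
    (hB : BoundaryExpanding r₀ I) {B : BridgeData n m} {e g₀ : Fin m} {u : Fin n} {κ₀ : ZMod 2} (hD : GateDataX I r₀ B e g₀ u κ₀)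
    {mv : V2} (hmvT : mv = (0, 1) ∨ mv = (1, 1))
    (hP : ∀ e' ∈ B.N, e' ≠ e → ∀ a, ((sys I B).ρ e' a = 0 ∨ (sys I B).ρ e' a = mv) ∧ ((sys I B).ρ' e' a = 0 ∨ (sys I B).ρ' e' a = mv))
    (hread : ∀ e' ∈ B.N, e' ≠ e → ∀ a, (sys I B).ρ e' a ≠ 0 ∨ (sys I B).ρ' e' a ≠ 0)
    (hq : IsAffineFn (qDir I B mv)) {j : Fin m} (hj : j ∈ B.J₀ \ B.N)
    (hpriv : ∀ j' ∈ insert g₀ B.J₀, j' ≠ j → I.vars j 2 ∉ varSet I j' ∧ I.vars j 3 ∉ varSet I j') :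
    j ∈ B.D e ∧ I.vars j 2 ≠ u ∧ I.vars j 3 ≠ u ∧ ∀ j' ∈ B.D e, j' ≠ j → I.vars j 2 ∉ andPair I j' ∧ I.vars j 3 ∉ andPair I j' := by
  classical
  obtain ⟨hXc, hW, hr, hd₁, hd₂, hL, -, -, hG, hg₀, hgv, -, -, -, -, -, hT3, hM0⟩ := id hD
  have he : e ∈ B.N := hG.1
  obtain ⟨hjJ, hjN⟩ := mem_sdiff.1 hj
  have hg₀J : g₀ ∉ B.J₀ := fun h => disjoint_left.1 hd₁ hg₀ h
  have hu_g₀ : u ∈ varSet I g₀ := by rcases hgv with ⟨-, h⟩ | ⟨h, -⟩ <;> exact h ▸ vars_mem_varSet I g₀ _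
  have hgj := hpriv g₀ (mem_insert_self _ _) (fun h => hg₀J (h ▸ hjJ))
  have hj2 : I.vars j 2 ≠ u := fun h => hgj.1 (h ▸ hu_g₀)
  have hj3 : I.vars j 3 ≠ u := fun h => hgj.2 (h ▸ hu_g₀)
  have hDpriv : ∀ D ⊆ B.J₀, ∀ j' ∈ D, j' ≠ j → I.vars j 2 ∉ andPair I j' ∧ I.vars j 3 ∉ andPair I j' := fun D hD' j' hj' hne =>
    ⟨fun h => (hpriv j' (mem_insert_of_mem (hD' hj')) hne).1 (andPair_subset_varSet I j' h),
     fun h => (hpriv j' (mem_insert_of_mem (hD' hj')) hne).2 (andPair_subset_varSet I j' h)⟩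
  have hDeJ : B.D e ⊆ B.J₀ := fun k hk => (mem_sdiff.1 (hW.hD e he hk)).1
  -- `j ∈ D e`
  have hjD : j ∈ B.D e := by
    by_contra hjDe
    -- on another fundamental set, `j` would be that chord's `u`-edge
    have hjDc : ∀ c ∈ B.N, j ∉ B.D c := by
      intro c hc hjc
      by_cases hce : c = e
      · exact hjDe (hce ▸ hjc)
      have hthr := (caseT_through I hI hT hS hB hD hmvT hP hread hc hce).1 j (Finset.mem_symmDiff.2 (Or.inr ⟨hjc, hjDe⟩))
      rcases hthr with h | h
      · exact hj2 h
      · exact hj3 h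
    -- `polarDir mv = 0`, so `[j ∈ T₁]·mv.2 + [j ∈ T₂]·mv.1 = 0`
    have hpol0 : polarDir I B mv = 0 := by
      refine polar_unique (qDir_add I B mv) (fun x w => ?_)
      rw [LinearMap.zero_apply, LinearMap.zero_apply, add_zero]
      exact hq x w
    have hτ : (if j ∈ B.T₁ then (1 : ZMod 2) else 0) * mv.2 + (if j ∈ B.T₂ then (1 : ZMod 2) else 0) * mv.1 = 0 := by
      have h := polarDir_single_pair I hI hS hd₁ hd₂ mv hjJ
      rw [hpol0, LinearMap.zero_apply, LinearMap.zero_apply] at h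
      rw [mul_comm _ mv.2, mul_comm _ mv.1]
      exact h.symm
    by_cases hjT₂ : j ∈ B.T₂
    · -- read by the second constraint: four chamber points off `u_e`
      have hτ2 : polarDir I B (1, 0) (Pi.single (I.vars j 2) 1) (Pi.single (I.vars j 3) 1) = 1 := by
        have h := polarDir_single_pair I hI hS hd₁ hd₂ (1, 0) hjJ
        simp only [zero_mul, zero_add, one_mul, if_pos hjT₂] at h
        exact h
      obtain ⟨y, hyu, hUy⟩ := exists_off_on_chamber I hI hS hW he u (κ₀ + 1)
      set a := I.vars j 2 with ha
      set b := I.vars j 3 with hb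
      set ea : Fin n → ZMod 2 := Pi.single a 1 with hea
      set eb : Fin n → ZMod 2 := Pi.single b 1 with heb
      have haDe : a ∉ (B.D e).biUnion (andPair I) := by
        intro h; obtain ⟨j', hj', hv⟩ := mem_biUnion.1 h
        exact (hDpriv _ hDeJ j' hj' (fun h' => hjDe (h' ▸ hj'))).1 hv
      have hbDe : b ∉ (B.D e).biUnion (andPair I) := by
        intro h; obtain ⟨j', hj', hv⟩ := mem_biUnion.1 h
        exact (hDpriv _ hDeJ j' hj' (fun h' => hjDe (h' ▸ hj'))).2 hv
      have hUU : ∀ y w, (sys I B).u e (y + w) = (sys I B).u e y + (sys I B).u e w + (sys I B).u e 0 +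
          polar (B.D e) (fun j => I.vars j 2) (fun j => I.vars j 3) y w := u_add I B e
      have hU0 : ∀ v : Fin n, (sys I B).u e (Pi.single v 1) = (sys I B).u e 0 := by
        intro v; rw [sys_u_eq, sys_u_eq, qform_single_and I hI]; unfold qform; simp
      have hsym : ∀ y w, polar (B.D e) (fun j => I.vars j 2) (fun j => I.vars j 3) y w =
          polar (B.D e) (fun j => I.vars j 2) (fun j => I.vars j 3) w y := PstarPathRank.polar_symm_and I (B.D e)
      have hUa : ∀ y', (sys I B).u e (y' + ea) = (sys I B).u e y' := by
        intro y'
        rw [hUU, hsym, hea, polar_single_off I (B.D e) haDe, hU0]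
        generalize (sys I B).u e y' = s; generalize (sys I B).u e 0 = t; revert s t; decide
      have hUb : ∀ y', (sys I B).u e (y' + eb) = (sys I B).u e y' := by
        intro y'
        rw [hUU, hsym, heb, polar_single_off I (B.D e) hbDe, hU0]
        generalize (sys I B).u e y' = s; generalize (sys I B).u e 0 = t; revert s t; decide
      have hoff : ∀ y' : Fin n → ZMod 2, y' u = κ₀ + 1 → (sys I B).u e y' = 0 →
          qDir I B (1, 0) y' = 1 + ∑ i ∈ B.N.erase e, (((sys I B).ρ i 0).2 + ((sys I B).ρ' i 0).2) := by
        intro y' hy'u hUy'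
        have h := caseT_off_q I hI hT hD hmvT hP hread hy'u hUy'
        rw [sigma_const I hW hG] at h
        exact h
      have hau : ea u = 0 := by rw [hea, Pi.single_eq_of_ne (Ne.symm hj2)]
      have hbu : eb u = 0 := by rw [heb, Pi.single_eq_of_ne (Ne.symm hj3)]
      have h1 := hoff y hyu hUy
      have h2 := hoff (y + ea) (by rw [Pi.add_apply, hyu, hau, add_zero]) (by rw [hUa, hUy])
      have h3 := hoff (y + eb) (by rw [Pi.add_apply, hyu, hbu, add_zero]) (by rw [hUb, hUy])
      have h4 := hoff (y + ea + eb) (by rw [Pi.add_apply, Pi.add_apply, hyu, hau, hbu, add_zero, add_zero]) (by rw [hUb, hUa, hUy])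
      have hquad := quad_two (qDir_add I B (1, 0)) y ea eb
      rw [h1, h2, h3, h4, hτ2] at hquad
      generalize ∑ i ∈ B.N.erase e, (((sys I B).ρ i 0).2 + ((sys I B).ρ' i 0).2) = s at hquad
      revert hquad; revert s; decide
    · -- unread: `j ∉ T₁` as well, and minimality at `j` lifts to a solution
      have hjT₁ : j ∉ B.T₁ := by
        intro hjT₁
        rw [if_pos hjT₁, if_neg hjT₂, one_mul, zero_mul, add_zero] at hτ
        rcases hmvT with h | h <;> rw [h] at hτ <;> exact one_ne_zero hτ
      have hinf : (sys I B).Infeasible B.N := infeasible_of_not_solution I hI hT hW hL hT3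
      obtain ⟨z, hz⟩ := hM0 j hjJ
      exact false_of_bridge_minimal I hI hT hW hXc hinf hj hjDc hjT₁ hjT₂ hz
  exact ⟨hjD, hj2, hj3, hDpriv _ hDeJ⟩

end Summit.PneNP.PneNP.Theorems.PstarGateCaseTN3Tools
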